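import Mathlib
import Literature.Probability.LatticeModels.GKSInequalities
import Summits.CriticalPhenomena.Ising3DConformalLimit.Theorems.PrecisionLaplacianInverseMFerromagnetPcovOfIm
import Summits.CriticalPhenomena.Ising3DConformalLimit.Theorems.PrecisionLaplacianInverseMFerromagnetEntryNonposOfPcov
import Summits.CriticalPhenomena.Ising3DConformalLimit.Theorems.PrecisionLaplacianMoebiusLimitOfTwoPointLawAmpLebTriangleOfInverseMAux
import HarnessLib

/-!
# Crux `PrecisionLaplacian.MoebiusLimitOfTwoPointLaw` (stmt-CriticalPhenomena-4801), line `Sketch` —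
# stub `stub_amputatedLebowitz_triangle_of_inverseM` (IM ⇒ VP¹ off the triple: the ghost)

THEOREM-ONLY file (no definitions).  Let `μ = gksExpect univ K C` be a zero-field pair ferromagnet
on `Fin n` (`K ≥ 0`, `|C i| = 2`), `X = {x₂, x₃, x₄}` a distinct triple, `z ∉ X`, `ε > 0`.  Assuming
the crux `InverseMFerromagnet` (IM) we show that for `t = λ(ε) = (log cosh 3ε − log cosh ε)/4 ∈ [0, ε]`
the VP¹ charge `∑_a (Σ_t⁻¹)_{za} (Wick_t(a) − u_t(a))` of the TARGET system `μ_t` (the three bonds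
`{x₃,x₄}, {x₂,x₄}, {x₂,x₃}` of coupling `t` appended) is `≥ 0` at `z`; here `Σ_t = (⟨σ_pσ_q⟩_t)`,
`u_t(a) = ⟨σ_aσ_{x₂}σ_{x₃}σ_{x₄}⟩_t`.

Proof (the ghost).  Since `Σ_t⁻¹Σ_t = 1` and `z ∉ X`, the charge is `−β_z`, `β = Σ_t⁻¹u_t`.  Add a
ghost site `g` coupled `ε` to `x₂, x₃, x₄` (sites `Fin (n+1)`, `g = Fin.last n`); IM through
`stub_pcov_of_im` gives `PCov(z, g | S) ≥ 0`, `S = univ ∖ {z, g}`, for the second-moment matrix `G`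
of the extension.  Summing out `σ_g` (`…AmpLebTriangleOfInverseMAux`: `cosh(ε(σ₂+σ₃+σ₄)) =
e^c e^{t(σ₃σ₄+σ₂σ₄+σ₂σ₃)}`, `ghost_walsh`) the marginal on the old spins is `μ_t`
(`ghost_gksExpect_ext`) and `G_{qg} = ⟨f σ_q⟩_t` with `f = tanh(ε(σ₂+σ₃+σ₄)) = α(σ₂+σ₃+σ₄) + κσ₂σ₃σ₄`,
`κ = (tanh 3ε − 3 tanh ε)/4 < 0` (`ghost_gksExpect_ext_odd`, `ghost_kappa_neg`).  Hence, with
`v(a) = ⟨f σ_a⟩_t = α(Σ_t)_{a x₂} + α(Σ_t)_{a x₃} + α(Σ_t)_{a x₄} + κ u_t(a)`,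
`PCov = v_z − (Σ_t)_{zS}((Σ_t)_{SS})⁻¹ v_S = s · (Σ_t⁻¹ v)_z = s κ β_z` by the one-point Schur identity
`ghost_schur_row` (`s > 0`, `ghost_schur_pos`; the Wick columns vanish again), so `β_z ≤ 0`.
-/

namespace Summit.CriticalPhenomena.Ising3DConformalLimit.PrecisionLaplacianMoebiusLimitOfTwoPointLaw

open Literature.Probability.LatticeModels Finset Matrix
open Summit.CriticalPhenomena.Ising3DConformalLimit.Cruxes.InverseMFerromagnet.PartialCovarianceLadder
  (stub_pcov_of_im schur_posDef pcm2im_gksExpect_add pcm2im_gksExpect_const_mul)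

/-- Registered stub `stub_amputatedLebowitz_triangle_of_inverseM` (tooth of line `Sketch`, the
ghost construction): `InverseMFerromagnet` implies that for a distinct triple `X = {x₂,x₃,x₄} ∌ z`
and every `ε > 0` there is `t ∈ [0, ε]` (namely `t = (log cosh 3ε − log cosh ε)/4`) such that the
VP¹ charge at `z` of the system with the extra bonds `{x₃,x₄}, {x₂,x₄}, {x₂,x₃}` of coupling `t` is
nonnegative.  IM at `(z, g)` for a ghost `g` coupled `ε` to `X` (`stub_pcov_of_im`) is, after
summing out `σ_g` (`ghost_gksExpect_ext`, `ghost_gksExpect_ext_odd`, `ghost_walsh`), the inequality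
`s κ β_z ≥ 0` with `s > 0` (`ghost_schur_row`, `ghost_schur_pos`), `κ < 0` (`ghost_kappa_neg`) and
`−β_z = −(Σ_t⁻¹u_t)_z` the charge. [folklore] -/
theorem stub_amputatedLebowitz_triangle_of_inverseM :
    Summit.CriticalPhenomena.Ising3DConformalLimit.Theses.PrecisionLaplacian.InverseMFerromagnet →
    ∀ (n m : ℕ) (K : Fin m → ℝ) (C : Fin m → Finset (Fin n)), (∀ i, 0 ≤ K i) → (∀ i, (C i).card = 2) →
      ∀ z x₂ x₃ x₄ : Fin n, (x₂ ≠ x₃ ∧ x₂ ≠ x₄ ∧ x₃ ≠ x₄) → ¬ (z = x₂ ∨ z = x₃ ∨ z = x₄) →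
        ∀ ε : ℝ, 0 < ε → ∃ t : ℝ, 0 ≤ t ∧ t ≤ ε ∧
        0 ≤ ∑ a : Fin n,
          (Matrix.of fun (p q : Fin n) =>
              gksExpect Finset.univ (Fin.append K (fun _ : Fin 3 => t))
                (Fin.append C ![{x₃, x₄}, {x₂, x₄}, {x₂, x₃}]) (fun ω => spinAt p ω * spinAt q ω))⁻¹ z a *
            (gksExpect Finset.univ (Fin.append K (fun _ : Fin 3 => t))
                  (Fin.append C ![{x₃, x₄}, {x₂, x₄}, {x₂, x₃}]) (fun ω => spinAt a ω * spinAt x₂ ω) *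
                gksExpect Finset.univ (Fin.append K (fun _ : Fin 3 => t))
                  (Fin.append C ![{x₃, x₄}, {x₂, x₄}, {x₂, x₃}]) (fun ω => spinAt x₃ ω * spinAt x₄ ω) +
              gksExpect Finset.univ (Fin.append K (fun _ : Fin 3 => t))
                  (Fin.append C ![{x₃, x₄}, {x₂, x₄}, {x₂, x₃}]) (fun ω => spinAt a ω * spinAt x₃ ω) *
                gksExpect Finset.univ (Fin.append K (fun _ : Fin 3 => t))
                  (Fin.append C ![{x₃, x₄}, {x₂, x₄}, {x₂, x₃}]) (fun ω => spinAt x₂ ω * spinAt x₄ ω) +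
              gksExpect Finset.univ (Fin.append K (fun _ : Fin 3 => t))
                  (Fin.append C ![{x₃, x₄}, {x₂, x₄}, {x₂, x₃}]) (fun ω => spinAt a ω * spinAt x₄ ω) *
                gksExpect Finset.univ (Fin.append K (fun _ : Fin 3 => t))
                  (Fin.append C ![{x₃, x₄}, {x₂, x₄}, {x₂, x₃}]) (fun ω => spinAt x₂ ω * spinAt x₃ ω) -
              gksExpect Finset.univ (Fin.append K (fun _ : Fin 3 => t))
                  (Fin.append C ![{x₃, x₄}, {x₂, x₄}, {x₂, x₃}])
                (fun ω => spinAt a ω * spinAt x₂ ω * spinAt x₃ ω * spinAt x₄ ω)) := by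
  intro hIM n m K C hK hC z x₂ x₃ x₄ hd hz ε hε
  obtain ⟨h23, h24, h34⟩ := hd
  have hz2 : z ≠ x₂ := fun h => hz (Or.inl h)
  have hz3 : z ≠ x₃ := fun h => hz (Or.inr (Or.inl h))
  have hz4 : z ≠ x₄ := fun h => hz (Or.inr (Or.inr h))
  refine ⟨(Real.log (Real.cosh (3 * ε)) - Real.log (Real.cosh ε)) / 4, ghost_t_nonneg ε,
    ghost_t_le hε.le, ?_⟩
  -- the constants of the ghost construction
  set t : ℝ := (Real.log (Real.cosh (3 * ε)) - Real.log (Real.cosh ε)) / 4 with ht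
  set κ : ℝ := (Real.tanh (3 * ε) - 3 * Real.tanh ε) / 4 with hκ
  set α : ℝ := (Real.tanh (3 * ε) + Real.tanh ε) / 4 with hα
  set c : ℝ := (Real.log (Real.cosh (3 * ε)) + 3 * Real.log (Real.cosh ε)) / 4 with hc
  have hκ0 : κ < 0 := ghost_kappa_neg hε
  have hcoshW : ∀ σ : SpinConfig (Fin n), Real.cosh (ε * (spinAt x₂ σ + spinAt x₃ σ + spinAt x₄ σ))
      = Real.exp c * Real.exp (t * (spinAt x₃ σ * spinAt x₄ σ + spinAt x₂ σ * spinAt x₄ σ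
          + spinAt x₂ σ * spinAt x₃ σ)) := fun σ =>
    (ghost_walsh ε _ _ _ (spinAt_eq_one_or_eq_neg_one x₂ σ) (spinAt_eq_one_or_eq_neg_one x₃ σ)
      (spinAt_eq_one_or_eq_neg_one x₄ σ)).2
  have htanhW : ∀ σ : SpinConfig (Fin n), Real.tanh (ε * (spinAt x₂ σ + spinAt x₃ σ + spinAt x₄ σ))
      = α * (spinAt x₂ σ + spinAt x₃ σ + spinAt x₄ σ)
        + κ * (spinAt x₂ σ * spinAt x₃ σ * spinAt x₄ σ) := fun σ =>
    (ghost_walsh ε _ _ _ (spinAt_eq_one_or_eq_neg_one x₂ σ) (spinAt_eq_one_or_eq_neg_one x₃ σ)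
      (spinAt_eq_one_or_eq_neg_one x₄ σ)).1
  -- the target system and its second-moment matrix `N`
  set Kt : Fin (m + 3) → ℝ := Fin.append K (fun _ : Fin 3 => t) with hKt
  set Ct : Fin (m + 3) → Finset (Fin n) := Fin.append C ![{x₃, x₄}, {x₂, x₄}, {x₂, x₃}] with hCt
  set N : Matrix (Fin n) (Fin n) ℝ :=
    Matrix.of fun p q : Fin n => gksExpect Finset.univ Kt Ct (fun ω => spinAt p ω * spinAt q ω)
    with hN
  have hNe : ∀ p q, gksExpect Finset.univ Kt Ct (fun ω => spinAt p ω * spinAt q ω) = N p q :=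
    fun p q => rfl
  simp only [hNe]
  set u : Fin n → ℝ := fun a => gksExpect Finset.univ Kt Ct
    (fun ω => spinAt a ω * spinAt x₂ ω * spinAt x₃ ω * spinAt x₄ ω) with hu
  have hue : ∀ a, gksExpect Finset.univ Kt Ct
      (fun ω => spinAt a ω * spinAt x₂ ω * spinAt x₃ ω * spinAt x₄ ω) = u a := fun a => rfl
  simp only [hue]
  -- `N` is positive definite; `N⁻¹ N = 1` kills the three Wick columns
  have hPD : N.PosDef := schur_posDef n (m + 3) Kt Ct
  have hNN : N⁻¹ * N = 1 :=
    Matrix.nonsing_inv_mul N ((Matrix.isUnit_iff_isUnit_det N).mp hPD.isUnit)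
  have hcol : ∀ x, z ≠ x → ∑ a, N⁻¹ z a * N a x = 0 := fun x hx => by
    have h := congrFun (congrFun hNN z) x
    rwa [Matrix.mul_apply, Matrix.one_apply_ne hx] at h
  have hgoal : ∑ a, N⁻¹ z a * (N a x₂ * N x₃ x₄ + N a x₃ * N x₂ x₄ + N a x₄ * N x₂ x₃ - u a)
      = -(N⁻¹.mulVec u) z := by
    have e : ∀ a, N⁻¹ z a * (N a x₂ * N x₃ x₄ + N a x₃ * N x₂ x₄ + N a x₄ * N x₂ x₃ - u a)
        = (N⁻¹ z a * N a x₂) * N x₃ x₄ + (N⁻¹ z a * N a x₃) * N x₂ x₄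
          + (N⁻¹ z a * N a x₄) * N x₂ x₃ - N⁻¹ z a * u a := fun a => by ring
    simp only [e, Finset.sum_sub_distrib, Finset.sum_add_distrib, ← Finset.sum_mul,
      hcol x₂ hz2, hcol x₃ hz3, hcol x₄ hz4, zero_mul, add_zero, zero_sub]
    rfl
  rw [hgoal, neg_nonneg]
  -- the ghost extension on `Fin (n+1)`, ghost `g = Fin.last n`
  set Ke : Fin (m + 3) → ℝ := Fin.append K (fun _ : Fin 3 => ε) with hKe
  set Ce : Fin (m + 3) → Finset (Fin (n + 1)) := Fin.append (fun i => (C i).map Fin.castSuccEmb)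
    ![{Fin.last n, x₂.castSucc}, {Fin.last n, x₃.castSucc}, {Fin.last n, x₄.castSucc}] with hCe
  have hKe0 : ∀ i, 0 ≤ Ke i := by
    intro i
    induction i using Fin.addCases with
    | left i => rw [hKe, Fin.append_left]; exact hK i
    | right j => rw [hKe, Fin.append_right]; exact hε.le
  have hCe2 : ∀ i, (Ce i).card = 2 := by
    intro i
    induction i using Fin.addCases with
    | left i => rw [hCe, Fin.append_left, Finset.card_map]; exact hC i
    | right j =>
        rw [hCe, Fin.append_right]
        fin_cases j <;>
          simp [Finset.card_pair (Fin.castSucc_ne_last _).symm]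
  obtain ⟨G, hG⟩ : ∃ G : Matrix (Fin (n + 1)) (Fin (n + 1)) ℝ, G = Matrix.of
      fun p q : Fin (n + 1) => gksExpect Finset.univ Ke Ce (fun ω => spinAt p ω * spinAt q ω) :=
    ⟨_, rfl⟩
  obtain ⟨S, hS⟩ : ∃ S : Finset (Fin (n + 1)), S = (Finset.univ.erase z.castSucc).erase (Fin.last n) :=
    ⟨_, rfl⟩
  have hzg : z.castSucc ≠ Fin.last n := Fin.castSucc_ne_last z
  have hzS : z.castSucc ∉ S := by simp [hS]
  have hgS : Fin.last n ∉ S := by simp [hS]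
  have hpcov := stub_pcov_of_im hIM (n + 1) (m + 3) Ke Ce hKe0 hCe2 G hG z.castSucc (Fin.last n) S
    hzg hzS hgS
  -- transfer of the entries of `G` to the target system
  have hE2 : ∀ a b : Fin n, G a.castSucc b.castSucc = N a b := fun a b => by
    rw [hG, Matrix.of_apply]
    exact ghost_gksExpect_ext K C ε t c h23 h24 h34 hcoshW (fun σ => spinAt a σ * spinAt b σ)
  set v : Fin n → ℝ := fun a => gksExpect Finset.univ Kt Ct
    (fun σ => Real.tanh (ε * (spinAt x₂ σ + spinAt x₃ σ + spinAt x₄ σ)) * spinAt a σ) with hv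
  have hEg : ∀ a : Fin n, G a.castSucc (Fin.last n) = v a := fun a => by
    rw [hG, Matrix.of_apply]
    have h1 : (fun ω : SpinConfig (Fin (n + 1)) => spinAt a.castSucc ω * spinAt (Fin.last n) ω)
        = fun ω => spinAt (Fin.last n) ω * spinAt a (fun i => ω i.castSucc) :=
      funext fun ω => mul_comm _ _
    rw [h1]
    exact ghost_gksExpect_ext_odd K C ε t c h23 h24 h34 hcoshW (spinAt a)
  -- the enumeration `gS : ↥S → Fin n` of `Fin n ∖ {z}`
  have hpS : ∀ p : ↥S, p.1 ≠ Fin.last n ∧ p.1 ≠ z.castSucc := fun p => by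
    have h : p.1 ∈ (Finset.univ.erase z.castSucc).erase (Fin.last n) := by rw [← hS]; exact p.2
    rw [Finset.mem_erase, Finset.mem_erase] at h
    exact ⟨h.1, h.2.1⟩
  obtain ⟨gS, hgSd⟩ : ∃ gS : ↥S → Fin n, ∀ p, gS p = p.1.castPred (hpS p).1 := ⟨_, fun _ => rfl⟩
  have hgSc : ∀ p : ↥S, (gS p).castSucc = p.1 := fun p => by rw [hgSd, Fin.castSucc_castPred]
  have hgSinj : Function.Injective gS := fun p q h =>
    Subtype.ext (by rw [← hgSc p, ← hgSc q, h])
  have hgSz : ∀ p, gS p ≠ z := fun p h => (hpS p).2 (by rw [← hgSc p, h])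
  have hgSsurj : ∀ a, a ≠ z → ∃ p, gS p = a := fun a ha => by
    have haS : a.castSucc ∈ S := by
      rw [hS, Finset.mem_erase, Finset.mem_erase]
      exact ⟨Fin.castSucc_ne_last a, fun h => ha (Fin.castSucc_injective _ h), Finset.mem_univ _⟩
    exact ⟨⟨a.castSucc, haS⟩, Fin.castSucc_injective _ (by rw [hgSc])⟩
  have hsub : G.submatrix (Subtype.val : ↥S → Fin (n + 1)) (Subtype.val : ↥S → Fin (n + 1))
      = N.submatrix gS gS := by
    ext p q
    simp only [Matrix.submatrix_apply]
    rw [← hE2, hgSc, hgSc]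
  have h1 : G z.castSucc (Fin.last n) = v z := hEg z
  have h2 : ∀ p : ↥S, G z.castSucc p.1 = N z (gS p) := fun p => by rw [← hE2, hgSc]
  have h3 : ∀ q : ↥S, G q.1 (Fin.last n) = v (gS q) := fun q => by rw [← hEg, hgSc]
  rw [h1, hsub] at hpcov
  simp only [h2, h3] at hpcov
  rw [ghost_schur_row N hPD z gS hgSinj hgSz hgSsurj v] at hpcov
  have hw : 0 ≤ (N⁻¹.mulVec v) z :=
    nonneg_of_mul_nonneg_right hpcov (ghost_schur_pos N hPD z gS hgSinj hgSz hgSsurj)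
  -- `N⁻¹ v = κ N⁻¹ u` in the `z`-entry (Walsh form of `tanh`, the Wick columns vanish)
  have hvu : ∀ a, v a = α * N a x₂ + α * N a x₃ + α * N a x₄ + κ * u a := fun a => by
    have hf : (fun σ : SpinConfig (Fin n) =>
        Real.tanh (ε * (spinAt x₂ σ + spinAt x₃ σ + spinAt x₄ σ)) * spinAt a σ)
        = fun σ => (α * (spinAt a σ * spinAt x₂ σ) + α * (spinAt a σ * spinAt x₃ σ))
          + (α * (spinAt a σ * spinAt x₄ σ)
            + κ * (spinAt a σ * spinAt x₂ σ * spinAt x₃ σ * spinAt x₄ σ)) :=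
      funext fun σ => by rw [htanhW]; ring
    rw [hv]
    simp only []
    rw [hf, pcm2im_gksExpect_add, pcm2im_gksExpect_add, pcm2im_gksExpect_add,
      pcm2im_gksExpect_const_mul, pcm2im_gksExpect_const_mul, pcm2im_gksExpect_const_mul,
      pcm2im_gksExpect_const_mul]
    simp only [hNe, hue]
    ring
  have hfin : (N⁻¹.mulVec v) z = κ * (N⁻¹.mulVec u) z := by
    simp only [Matrix.mulVec, dotProduct, hvu]
    have e : ∀ a, N⁻¹ z a * (α * N a x₂ + α * N a x₃ + α * N a x₄ + κ * u a)
        = (N⁻¹ z a * N a x₂) * α + (N⁻¹ z a * N a x₃) * α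
          + (N⁻¹ z a * N a x₄) * α + κ * (N⁻¹ z a * u a) := fun a => by ring
    simp only [e, Finset.sum_add_distrib, ← Finset.sum_mul, ← Finset.mul_sum,
      hcol x₂ hz2, hcol x₃ hz3, hcol x₄ hz4, zero_mul, zero_add]
  rw [hfin] at hw
  exact nonpos_of_mul_nonneg_right hw hκ0

end Summit.CriticalPhenomena.Ising3DConformalLimit.PrecisionLaplacianMoebiusLimitOfTwoPointLaw
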